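import Literature.MathematicalPhysics.QuantumFieldTheory.Balaban1983to89.B16Txt357ThirdOrderU1
import Literature.MathematicalPhysics.QuantumFieldTheory.Balaban1983to89.B16Sect1Wilson

/-!
# N21 (NE7c) · THE SECOND-ORDER ROW OF THE [LF-II] (1.2) REMAINDER IN THE ABELIAN MODEL: the quadratic-remainder ∕
# semiconvexity letter of `g⁻²V` for the `U(1)` block action, and CONVEXITY of the abelian (1.2) exponent for `g` small

Width seat pub-ymgap-dag-n21-w5 (g0; director-ym R399 (3a) ∕ №209 second wave, dag-lead WIDTH-209), node N21 = NE7c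
(single-run shell-weight bound, NOT PRINTED in [Bałaban 1983–89], NOT proved), lane K3⁷ `SpineGivenEndpointR13SepCoPH`
(stmt-QuantumFields-20544, `--kind proof --supports … --as helper`).  The INPUTS ∕ MODEL-INSTANCE hand of WIDTH-209 N21
piece 2 «CONVEXITY of the [LF-II] (1.2) exponent on the chart ⇒ printed-row form of `hK ∕ hφ`» (pen: dag-n21-w3 g3,
`…N21ChartExponentConvexity`, whose ★ takes a quadratic-remainder letter `Mq` for the remainder `Vt` as a HYPOTHESIS).

THE POINT.  For the (1.2) exponent `φ(B′) = ½⟨H B′, Δ₁(ζ₀) H B′⟩ + (1∕g_k)⟨D H B′, ζ₀η⁻² Im ∂U₀⟩ + g_k⁻²V(ζ₀, g_k H B′)` of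
[Balaban1989LargeFieldII] p. 357, print gives for `V` only the VALUE row *"V is at least of third order in the argument.
It can be estimated by O(g_k^{1−β})|Λ|"* (tree `B16Sect1Statements.Ineq12V`, PROVED for the abelian model in
`B16Txt357ThirdOrderU1`: `V = Σ_p ζ₀(p)·rem₃(θ_p, g·φ_p)`, `rem₃(θ, h) = [1 − cos(θ+h)] − [1 − cos θ] − h sin θ − ½h² cos θ`).
Convexity of `φ` needs a SECOND-ORDER row for `V` (NOT PRINTED).  Here it is PROVED for the same abelian model instance,
with the rate `g¹`:
* §1 (one plaquette) the EXACT identity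
  `rem₃(θ, h′) − rem₃(θ, h) − (h′ − h)·∂_h rem₃(θ, h) = rem₃(θ + h, h′ − h) + ½(h′ − h)²(cos(θ + h) − cos θ)`
  (`∂_h rem₃(θ, h) = sin(θ + h) − sin θ − h cos θ`, `hasDerivAt_rem3`), whence with the tree's `|rem₃(a, δ)| ≤ |δ|³∕4` and
  `|cos(θ + h) − cos θ| ≤ |h|` the quadratic-remainder letter `|…| ≤ ρ·(h′ − h)²` on the window `|h|, |h′| ≤ ρ ≤ ½`, and its
  convex-combination form `rem₃(θ, au + bv) ≤ a·rem₃(θ, u) + b·rem₃(θ, v) + ρ·ab·(u − v)²`;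
* §2 (the block) for `Vt(B′) := g⁻²·V12 g ζ θ (∂H B′)` with `∂H` LINEAR and the window `|φ_p| ≤ Φ`, `gΦ ≤ ½`: the two-sided
  QUADRATIC-REMAINDER LETTER `|Vt y − Vt x − L_x(y − x)| ≤ gΦ·Σ_p ζ_p(φ_p(y − x))²` (`L_x` the explicit derivative
  functional) and the SEMICONVEXITY ROW `Vt(a•x + b•y) ≤ a·Vt x + b·Vt y + gΦ·ab·Σ_p ζ_p(φ_p(x − y))²` — dag-n21-w3's
  letter `Mq` INHABITED by the lattice cosine action with `Mq = gΦ·c_φ` (`Σ_p ζ_p(φ_p u)² ≤ c_φ·‖u‖²` a displayed letter);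
* §3 ★ `convexOn_sect1ExponentU1`: the abelian (1.2) exponent `c + ½B(v,v) + ℓ v + Vt v` (`B` bilinear with the (1.9) row
  `Ineq19 (B(x−y)(x−y)) (n(x−y)) γ₀ d M` on differences, `ℓ` linear) is CONVEX on every convex window under the ONE clause
  `4d(100M)^{d+1}·(gΦc_φ) ≤ γ₀`; the clause at print's bookkeeping `Φ ≤ K·p₀(g_k)` as a `g`-smallness line and in
  `∀ᶠ g → 0⁺` form when `g·p₀(g) → 0` (*"for g_k sufficiently small"*);
* §4 A6 (№189 (3)): every binder of ★ inhabited by an explicit one-plaquette lattice datum, the clause WITH EQUALITY — it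
  says that the one-plaquette weight `v ↦ 16(1 − cos(v∕4))` is log-concave… i.e. CONVEX, on `[−1, 1]`.

HONEST FRAMING.  [textbook] one-variable trigonometry ∕ convex combinations over the tree's `U(1)` MODEL INSTANCE
(abelian: no `D₃`∕BCH terms of [Balaban1987RG1] (2.6)–(2.7); for non-abelian `G` those are part of `V` and are NOT
reproduced); the identification of `(ζ₀, θ, ∂H = ∂H_{1,k}, Φ ≤ K·p₀(g_k), c_φ, B, ℓ)` with [LF-II] (1.2)'s members is LOCATED
typing (desk ME #34), NOT asserted; the second-order row itself is NOT PRINTED; nothing of Bałaban's asserted; NE7c NOT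
PRINTED ∕ NOT proved; N21 NOT discharged; K3⁷ NOT claimed; counts unmoved (typed 28∕28 · discharged 5∕27); count-neutral;
one finite 𝕋⁴ at fixed ε — R4 would close only the conditional finite-𝕋⁴ rung `BalabanLadder.UV`, NOT the Yang–Mills
mass gap (Clay); nothing about ℝ⁴ ∕ OS.  THEOREMS ONLY: 0 `def`, 0 `sorry`.
-/

set_option autoImplicit false

open Real Finset Set Filter
open scoped Topology

namespace Summit.QuantumFields.YangMills.Theorems.N21Sect1RemainderSecondOrderU1

open Literature.MathematicalPhysics.QuantumFieldTheory.Balaban1983to89.B16Txt357ThirdOrderU1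
  (rem3 abs_rem3_le V12 V12_eq_sum_rem3)
open Literature.MathematicalPhysics.QuantumFieldTheory.Balaban1983to89.B16Sect1Wilson (Ineq19)

/-! ## §1  One plaquette: the quadratic remainder of `rem₃(θ, ·)` -/

section OnePlaquette

/-- `∂_h rem₃(θ, h) = sin(θ + h) − sin θ − h cos θ` (the derivative of `1 − cos` at `θ + h` minus its first-order Taylor
polynomial at `θ`). [textbook] -/
theorem hasDerivAt_rem3 (θ h : ℝ) : HasDerivAt (rem3 θ) (sin (θ + h) - sin θ - h * cos θ) h := by
  have h1 : HasDerivAt (fun x : ℝ => θ + x) 1 h := (hasDerivAt_id h).const_add θ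
  have h2 : HasDerivAt (fun x : ℝ => cos (θ + x)) (-sin (θ + h) * 1) h :=
    (Real.hasDerivAt_cos (θ + h)).comp h h1
  have h3 : HasDerivAt (fun x : ℝ => x ^ 2 / 2 * cos θ) ((2 : ℕ) * h ^ (2 - 1) / 2 * cos θ) h :=
    ((hasDerivAt_pow 2 h).div_const 2).mul_const (cos θ)
  have h4 : HasDerivAt (fun x => (1 - cos (θ + x)) - (1 - cos θ) - x * sin θ - x ^ 2 / 2 * cos θ)
      (-(-sin (θ + h) * 1) - 1 * sin θ - (2 : ℕ) * h ^ (2 - 1) / 2 * cos θ) h :=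
    (((h2.const_sub 1).sub_const (1 - cos θ)).sub ((hasDerivAt_id h).mul_const (sin θ))).sub h3
  refine h4.congr_deriv ?_
  push_cast
  ring

/-- **THE EXACT SECOND-ORDER IDENTITY.**  The quadratic remainder of `rem₃(θ, ·)` between `h` and `h′` is the third-order
remainder of `1 − cos` at the shifted angle `θ + h` plus half the increment squared times the drift of the Hessian
`cos(θ + h) − cos θ`:
`rem₃(θ, h′) − rem₃(θ, h) − (h′ − h)·∂_h rem₃(θ, h) = rem₃(θ + h, h′ − h) + ½(h′ − h)²(cos(θ + h) − cos θ)`. [textbook] -/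
theorem rem3_quadraticRemainder_eq (θ h h' : ℝ) :
    rem3 θ h' - rem3 θ h - (h' - h) * (sin (θ + h) - sin θ - h * cos θ) =
      rem3 (θ + h) (h' - h) + (h' - h) ^ 2 / 2 * (cos (θ + h) - cos θ) := by
  have e : θ + h + (h' - h) = θ + h' := by ring
  unfold rem3
  rw [e]
  ring

/-- **THE QUADRATIC-REMAINDER LETTER OF ONE PLAQUETTE**: on the window `|h|, |h′| ≤ ρ ≤ ½`,
`|rem₃(θ, h′) − rem₃(θ, h) − (h′ − h)·∂_h rem₃(θ, h)| ≤ ρ·(h′ − h)²` (from §1's identity, the tree's `|rem₃(a, δ)| ≤ |δ|³∕4`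
for `|δ| ≤ 1`, and `|cos(θ + h) − cos θ| ≤ |h|`). [textbook] -/
theorem abs_rem3_quadraticRemainder_le {θ h h' ρ : ℝ} (hh : |h| ≤ ρ) (hh' : |h'| ≤ ρ) (hρ : ρ ≤ 1 / 2) :
    |rem3 θ h' - rem3 θ h - (h' - h) * (sin (θ + h) - sin θ - h * cos θ)| ≤ ρ * (h' - h) ^ 2 := by
  rw [rem3_quadraticRemainder_eq]
  have hδ : |h' - h| ≤ 2 * ρ := by
    calc |h' - h| ≤ |h'| + |h| := abs_sub _ _
      _ ≤ ρ + ρ := add_le_add hh' hh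
      _ = 2 * ρ := by ring
  have hδ1 : |h' - h| ≤ 1 := hδ.trans (by linarith)
  have hA : |rem3 (θ + h) (h' - h)| ≤ |h' - h| ^ 3 / 4 := abs_rem3_le hδ1
  have hB : |cos (θ + h) - cos θ| ≤ |h| := by
    simpa using Real.abs_cos_sub_cos_le (θ + h) θ
  have hsq : |h' - h| ^ 2 = (h' - h) ^ 2 := sq_abs _
  have h3 : |h' - h| ^ 3 = |h' - h| * (h' - h) ^ 2 := by rw [← hsq]; ring
  have h3a : |h' - h| ^ 3 / 4 ≤ 2 * ρ * (h' - h) ^ 2 / 4 := by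
    rw [h3]
    exact div_le_div_of_nonneg_right (mul_le_mul_of_nonneg_right hδ (sq_nonneg _)) (by norm_num)
  have h3b : |(h' - h) ^ 2 / 2 * (cos (θ + h) - cos θ)| ≤ (h' - h) ^ 2 / 2 * ρ := by
    rw [abs_mul, abs_of_nonneg (by positivity : (0 : ℝ) ≤ (h' - h) ^ 2 / 2)]
    exact mul_le_mul_of_nonneg_left (hB.trans hh) (by positivity)
  calc |rem3 (θ + h) (h' - h) + (h' - h) ^ 2 / 2 * (cos (θ + h) - cos θ)|
      ≤ |rem3 (θ + h) (h' - h)| + |(h' - h) ^ 2 / 2 * (cos (θ + h) - cos θ)| := abs_add_le _ _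
    _ ≤ 2 * ρ * (h' - h) ^ 2 / 4 + (h' - h) ^ 2 / 2 * ρ := add_le_add (hA.trans h3a) h3b
    _ = ρ * (h' - h) ^ 2 := by ring

/-- the algebra of two one-sided quadratic-remainder bounds about a convex combination: if `w = au + (1 − a)v` and
`R(u) − R(w) − (u − w)F ≥ −ρ(u − w)²`, `R(v) − R(w) − (v − w)F ≥ −ρ(v − w)²`, then `R(w) ≤ aR(u) + (1 − a)R(v) + ρa(1 − a)(u − v)²`
(the `F`-terms cancel: `a(u − w) + (1 − a)(v − w) = 0`; and `a(u − w)² + (1 − a)(v − w)² = a(1 − a)(u − v)²`). [textbook] -/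
theorem convexComb_le_of_quadraticRemainder {Ru Rv Rw F a u v w ρ : ℝ} (ha : 0 ≤ a) (hb : 0 ≤ 1 - a)
    (hw : w = a * u + (1 - a) * v)
    (h1 : -(ρ * (u - w) ^ 2) ≤ Ru - Rw - (u - w) * F) (h2 : -(ρ * (v - w) ^ 2) ≤ Rv - Rw - (v - w) * F) :
    Rw ≤ a * Ru + (1 - a) * Rv + ρ * (a * (1 - a)) * (u - v) ^ 2 := by
  have k1 : a * ((u - w) * F) + (1 - a) * ((v - w) * F) = 0 := by rw [hw]; ring
  have k2 : a * (ρ * (u - w) ^ 2) + (1 - a) * (ρ * (v - w) ^ 2) = ρ * (a * (1 - a)) * (u - v) ^ 2 := by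
    rw [hw]; ring
  have e1 := mul_le_mul_of_nonneg_left h1 ha
  have e2 := mul_le_mul_of_nonneg_left h2 hb
  linarith [e1, e2, k1, k2]

/-- **ONE PLAQUETTE, CONVEX-COMBINATION FORM**: on the window `|u|, |v| ≤ ρ ≤ ½`,
`rem₃(θ, au + bv) ≤ a·rem₃(θ, u) + b·rem₃(θ, v) + ρ·ab·(u − v)²` (`a, b ≥ 0`, `a + b = 1`) — the one-plaquette action's
third-order remainder is `2ρ`-SEMICONVEX on the window. [textbook] -/
theorem rem3_convexComb_le {θ u v a b ρ : ℝ} (ha : 0 ≤ a) (hb : 0 ≤ b) (hab : a + b = 1)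
    (hu : |u| ≤ ρ) (hv : |v| ≤ ρ) (hρ : ρ ≤ 1 / 2) :
    rem3 θ (a * u + b * v) ≤ a * rem3 θ u + b * rem3 θ v + ρ * (a * b) * (u - v) ^ 2 := by
  obtain rfl : b = 1 - a := by linarith
  set w := a * u + (1 - a) * v with hw
  have hwρ : |w| ≤ ρ := by
    calc |w| ≤ |a * u| + |(1 - a) * v| := abs_add_le _ _
      _ = a * |u| + (1 - a) * |v| := by rw [abs_mul, abs_mul, abs_of_nonneg ha, abs_of_nonneg hb]
      _ ≤ a * ρ + (1 - a) * ρ := add_le_add (mul_le_mul_of_nonneg_left hu ha) (mul_le_mul_of_nonneg_left hv hb)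
      _ = ρ := by ring
  have h1 := (abs_le.mp (abs_rem3_quadraticRemainder_le (θ := θ) hwρ hu hρ)).1
  have h2 := (abs_le.mp (abs_rem3_quadraticRemainder_le (θ := θ) hwρ hv hρ)).1
  exact convexComb_le_of_quadraticRemainder ha hb hw h1 h2

end OnePlaquette

/-! ## §2  The block: the second-order letters of `g⁻²V` for the abelian action along a LINEAR chart `B′ ↦ φ = ∂H B′` -/

section Block

variable {ι : Type*} [Fintype ι] {E : Type*} [AddCommGroup E] [Module ℝ E]

/-- **THE QUADRATIC-REMAINDER LETTER OF THE ABELIAN (1.2) REMAINDER** (dag-n21-w3's `Mq`, two-sided form, INHABITED by the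
lattice cosine action).  For `Vt(B′) := g⁻²·V12 g ζ θ (∂H B′)` read through a LINEAR `∂H : B′ ↦ φ`, a weight `ζ ≥ 0`, and two
points of the window `|φ_p| ≤ Φ`, `gΦ ≤ ½`, with the explicit derivative functional
`L_x(u) = g⁻¹·Σ_p ζ_p·(∂H u)_p·(sin(θ_p + g(∂H x)_p) − sin θ_p − g(∂H x)_p cos θ_p)`:
`|Vt y − Vt x − L_x(y − x)| ≤ gΦ·Σ_p ζ_p((∂H(y − x))_p)²`. [textbook] -/
theorem abs_V12_div_quadraticRemainder_le {g Φ : ℝ} (hg : 0 < g) (hgΦ : g * Φ ≤ 1 / 2) {ζ : ι → ℝ}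
    (hζ : ∀ p, 0 ≤ ζ p) (θ : ι → ℝ) (dH : E →ₗ[ℝ] (ι → ℝ)) {x y : E} (hx : ∀ p, |dH x p| ≤ Φ)
    (hy : ∀ p, |dH y p| ≤ Φ) :
    |1 / g ^ 2 * V12 g ζ θ (dH y) - 1 / g ^ 2 * V12 g ζ θ (dH x)
        - 1 / g * ∑ p, ζ p * dH (y - x) p * (sin (θ p + g * dH x p) - sin (θ p) - g * dH x p * cos (θ p))|
      ≤ g * Φ * ∑ p, ζ p * (dH (y - x) p) ^ 2 := by
  have hg0 : g ≠ 0 := hg.ne'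
  rw [V12_eq_sum_rem3, V12_eq_sum_rem3]
  simp only [map_sub, Pi.sub_apply]
  rw [Finset.mul_sum, Finset.mul_sum, Finset.mul_sum, ← Finset.sum_sub_distrib, ← Finset.sum_sub_distrib,
    Finset.mul_sum]
  refine (Finset.abs_sum_le_sum_abs _ _).trans (Finset.sum_le_sum fun p _ => ?_)
  have hu : |g * dH x p| ≤ g * Φ := by
    rw [abs_mul, abs_of_pos hg]; exact mul_le_mul_of_nonneg_left (hx p) hg.le
  have hv : |g * dH y p| ≤ g * Φ := by
    rw [abs_mul, abs_of_pos hg]; exact mul_le_mul_of_nonneg_left (hy p) hg.le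
  have hper := abs_rem3_quadraticRemainder_le (θ := θ p) hu hv hgΦ
  have e : 1 / g ^ 2 * (ζ p * rem3 (θ p) (g * dH y p)) - 1 / g ^ 2 * (ζ p * rem3 (θ p) (g * dH x p))
      - 1 / g * (ζ p * (dH y p - dH x p) * (sin (θ p + g * dH x p) - sin (θ p) - g * dH x p * cos (θ p))) =
      ζ p / g ^ 2 * (rem3 (θ p) (g * dH y p) - rem3 (θ p) (g * dH x p)
        - (g * dH y p - g * dH x p) * (sin (θ p + g * dH x p) - sin (θ p) - g * dH x p * cos (θ p))) := by
    field_simp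
  rw [e, abs_mul, abs_of_nonneg (by have := hζ p; positivity : (0 : ℝ) ≤ ζ p / g ^ 2)]
  calc ζ p / g ^ 2 * |rem3 (θ p) (g * dH y p) - rem3 (θ p) (g * dH x p)
        - (g * dH y p - g * dH x p) * (sin (θ p + g * dH x p) - sin (θ p) - g * dH x p * cos (θ p))|
      ≤ ζ p / g ^ 2 * (g * Φ * (g * dH y p - g * dH x p) ^ 2) :=
        mul_le_mul_of_nonneg_left hper (by have := hζ p; positivity)
    _ = g * Φ * (ζ p * (dH y p - dH x p) ^ 2) := by
        field_simp

/-- **THE SEMICONVEXITY ROW OF THE ABELIAN (1.2) REMAINDER.**  For `Vt(B′) := g⁻²·V12 g ζ θ (∂H B′)` — the `V`-term of (1.2)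
in the `U(1)` model, read through a LINEAR map `∂H : B′ ↦ φ` (print: `φ = ∂H_{1,k}B′`) — a weight `ζ ≥ 0`, and two points of
the window `|φ_p| ≤ Φ` with `gΦ ≤ ½`:
`Vt(a•x + b•y) ≤ a·Vt x + b·Vt y + gΦ·ab·Σ_p ζ_p(φ_p(x − y))²` (`a, b ≥ 0`, `a + b = 1`).
Two powers of `g` cancel the `g⁻²`, one is left: the second-order letter is `O(g·Φ)`, against the value row's
`O(g·Φ³)·#plaquettes` (`B16Txt357ThirdOrderU1.abs_V12_div_le`). [textbook] -/
theorem V12_div_convexComb_le {g Φ : ℝ} (hg : 0 < g) (hgΦ : g * Φ ≤ 1 / 2) {ζ : ι → ℝ} (hζ : ∀ p, 0 ≤ ζ p)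
    (θ : ι → ℝ) (dH : E →ₗ[ℝ] (ι → ℝ)) {x y : E} (hx : ∀ p, |dH x p| ≤ Φ) (hy : ∀ p, |dH y p| ≤ Φ)
    {a b : ℝ} (ha : 0 ≤ a) (hb : 0 ≤ b) (hab : a + b = 1) :
    1 / g ^ 2 * V12 g ζ θ (dH (a • x + b • y)) ≤
      a * (1 / g ^ 2 * V12 g ζ θ (dH x)) + b * (1 / g ^ 2 * V12 g ζ θ (dH y))
        + g * Φ * (a * b) * ∑ p, ζ p * (dH (x - y) p) ^ 2 := by
  have hg0 : g ≠ 0 := hg.ne'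
  rw [V12_eq_sum_rem3, V12_eq_sum_rem3, V12_eq_sum_rem3]
  simp only [map_add, map_smul, map_sub, Pi.add_apply, Pi.smul_apply, Pi.sub_apply, smul_eq_mul]
  rw [Finset.mul_sum, Finset.mul_sum, Finset.mul_sum, Finset.mul_sum, Finset.mul_sum, Finset.mul_sum,
    ← Finset.sum_add_distrib, ← Finset.sum_add_distrib]
  refine Finset.sum_le_sum fun p _ => ?_
  -- one plaquette at the scaled increments `g·φ_p`
  have hu : |g * dH x p| ≤ g * Φ := by
    rw [abs_mul, abs_of_pos hg]; exact mul_le_mul_of_nonneg_left (hx p) hg.le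
  have hv : |g * dH y p| ≤ g * Φ := by
    rw [abs_mul, abs_of_pos hg]; exact mul_le_mul_of_nonneg_left (hy p) hg.le
  have hper := rem3_convexComb_le (θ := θ p) ha hb hab hu hv hgΦ
  have e1 : g * (a * dH x p + b * dH y p) = a * (g * dH x p) + b * (g * dH y p) := by ring
  have e2 : g * Φ * (a * b) * (g * dH x p - g * dH y p) ^ 2 =
      g ^ 2 * (g * Φ * (a * b) * (dH x p - dH y p) ^ 2) := by ring
  rw [e1]
  rw [e2] at hper
  have key := mul_le_mul_of_nonneg_left hper (hζ p)
  have key' := mul_le_mul_of_nonneg_left key (le_of_lt (by positivity : (0 : ℝ) < 1 / g ^ 2))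
  have e3 : 1 / g ^ 2 * (ζ p * (g ^ 2 * (g * Φ * (a * b) * (dH x p - dH y p) ^ 2))) =
      g * Φ * (a * b) * (ζ p * (dH x p - dH y p) ^ 2) := by
    field_simp
  calc 1 / g ^ 2 * (ζ p * rem3 (θ p) (a * (g * dH x p) + b * (g * dH y p)))
      ≤ 1 / g ^ 2 * (ζ p * (a * rem3 (θ p) (g * dH x p) + b * rem3 (θ p) (g * dH y p) +
          g ^ 2 * (g * Φ * (a * b) * (dH x p - dH y p) ^ 2))) := key'
    _ = a * (1 / g ^ 2 * (ζ p * rem3 (θ p) (g * dH x p))) + b * (1 / g ^ 2 * (ζ p * rem3 (θ p) (g * dH y p)))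
          + g * Φ * (a * b) * (ζ p * (dH x p - dH y p) ^ 2) := by
        rw [← e3]; ring

/-- the bilinear bookkeeping of the (1.2) quadratic member along a chord: for a bilinear `B` and `a + b = 1`,
`B(ax + by, ax + by) = a·B(x,x) + b·B(y,y) − ab·B(x − y, x − y)`. [textbook] -/
theorem bilin_convexComb_eq (B : E →ₗ[ℝ] E →ₗ[ℝ] ℝ) (x y : E) {a b : ℝ} (hab : a + b = 1) :
    B (a • x + b • y) (a • x + b • y) = a * B x x + b * B y y - a * b * B (x - y) (x - y) := by
  obtain rfl : b = 1 - a := by linarith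
  simp only [map_add, map_smul, map_sub, LinearMap.add_apply, LinearMap.smul_apply, LinearMap.sub_apply,
    smul_eq_mul]
  ring

/-! ## §3  ★ Convexity of the abelian (1.2) exponent on the window, for `g` small -/

/-- ★ **CONVEXITY OF THE ABELIAN (1.2) EXPONENT ON THE WINDOW** — the printed-row form of the binder
`hφ : ConvexOn ℝ K φ` of the N21 ENDs (dag-n21-w1 p590709 ★★★ ∕ p604008 ★★★) in the `U(1)` model instance.  Data: a convex
window `K` on which `|(∂H v)_p| ≤ Φ` (print: `χ({|B′| < M₀g_k⁻¹ε_k})`, `ε_k = g_kA₀p₀(g_k)` ⇒ `Φ ≤ ‖∂H_{1,k}‖M₀A₀·p₀(g_k)`),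
`0 ≤ Φ`, `gΦ ≤ ½`; the exponent `A v = c + ½B(v,v) + ℓ v + g⁻²·V12 g ζ θ (∂H v)` on `K` ((1.2) with the `½`, desk ME #34;
`B` bilinear = *"the leading quadratic form ⟨H_{1,k}B′, Δ₁(ζ₀)H_{1,k}B′⟩"*, `ℓ` linear = the (1.5) member); the (1.9) row
`Ineq19 (B(x−y)(x−y)) (n(x−y)) γ₀ d M` on differences of window points for a nonnegative size letter `n` (print: `‖B′‖²`);
the comparison letter `Σ_p ζ_p((∂H u)_p)² ≤ c_φ·n(u)`; and the ONE clause `4d(100M)^{d+1}·(gΦc_φ) ≤ γ₀` (*"for g_k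
sufficiently small"*).  Then `A` is CONVEX on `K`: along a chord the quadratic member gains `½ab·B(x−y,x−y) ≥
½ab·γ₀∕(2d(100M)^{d+1})·n(x−y)` (§2 `bilin_convexComb_eq` + (1.9)) and the remainder loses at most `gΦ·ab·c_φ·n(x−y)`
(§2 `V12_div_convexComb_le`). [textbook] -/
theorem convexOn_sect1ExponentU1 {K : Set E} (hK : Convex ℝ K) (A : E → ℝ) (B : E →ₗ[ℝ] E →ₗ[ℝ] ℝ)
    (ℓ : E →ₗ[ℝ] ℝ) (c : ℝ) (n : E → ℝ) (dH : E →ₗ[ℝ] (ι → ℝ)) {ζ : ι → ℝ} (θ : ι → ℝ)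
    {g Φ cφ γ₀ M : ℝ} {d : ℕ} (hg : 0 < g) (hΦ : 0 ≤ Φ) (hgΦ : g * Φ ≤ 1 / 2) (hζ : ∀ p, 0 ≤ ζ p) (hd : 1 ≤ d)
    (hM : 0 < M)
    (hexp : ∀ v ∈ K, A v = c + 1 / 2 * B v v + ℓ v + 1 / g ^ 2 * V12 g ζ θ (dH v))
    (hwin : ∀ v ∈ K, ∀ p, |dH v p| ≤ Φ)
    (h19 : ∀ x ∈ K, ∀ y ∈ K, Ineq19 (B (x - y) (x - y)) (n (x - y)) γ₀ d M)
    (hn : ∀ x ∈ K, ∀ y ∈ K, 0 ≤ n (x - y))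
    (hcφ : ∀ x ∈ K, ∀ y ∈ K, ∑ p, ζ p * (dH (x - y) p) ^ 2 ≤ cφ * n (x - y))
    (hclause : 4 * d * (100 * M) ^ (d + 1) * (g * Φ * cφ) ≤ γ₀) :
    ConvexOn ℝ K A := by
  refine ⟨hK, fun x hx y hy a b ha hb hab => ?_⟩
  have hz : a • x + b • y ∈ K := hK hx hy ha hb hab
  rw [smul_eq_mul, smul_eq_mul, hexp _ hz, hexp x hx, hexp y hy]
  have hB := bilin_convexComb_eq B x y hab
  have hℓ : ℓ (a • x + b • y) = a * ℓ x + b * ℓ y := by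
    rw [map_add, map_smul, map_smul, smul_eq_mul, smul_eq_mul]
  have hV := V12_div_convexComb_le hg hgΦ hζ θ dH (hwin x hx) (hwin y hy) ha hb hab
  -- the (1.9) row on the difference, and the clause
  have hd0 : (0 : ℝ) < d := by exact_mod_cast hd
  have h19' : γ₀ / (2 * d * (100 * M) ^ (d + 1)) * n (x - y) ≤ B (x - y) (x - y) := h19 x hx y hy
  have hmq : g * Φ * cφ * n (x - y) ≤ 1 / 2 * (γ₀ / (2 * d * (100 * M) ^ (d + 1)) * n (x - y)) := by
    have h1 : g * Φ * cφ ≤ γ₀ / (4 * d * (100 * M) ^ (d + 1)) := by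
      rw [le_div_iff₀ (by positivity)]
      linarith
    have h2 : γ₀ / (4 * d * (100 * M) ^ (d + 1)) = 1 / 2 * (γ₀ / (2 * d * (100 * M) ^ (d + 1))) := by
      field_simp
      ring
    calc g * Φ * cφ * n (x - y) ≤ γ₀ / (4 * d * (100 * M) ^ (d + 1)) * n (x - y) :=
          mul_le_mul_of_nonneg_right h1 (hn x hx y hy)
      _ = 1 / 2 * (γ₀ / (2 * d * (100 * M) ^ (d + 1)) * n (x - y)) := by rw [h2]; ring
  have hab0 : 0 ≤ a * b := mul_nonneg ha hb
  have hrem : g * Φ * (a * b) * ∑ p, ζ p * (dH (x - y) p) ^ 2 ≤ a * b * (g * Φ * cφ * n (x - y)) := by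
    have := mul_le_mul_of_nonneg_left (hcφ x hx y hy) (mul_nonneg (mul_nonneg hg.le hΦ) hab0)
    calc g * Φ * (a * b) * ∑ p, ζ p * (dH (x - y) p) ^ 2 ≤ g * Φ * (a * b) * (cφ * n (x - y)) := this
      _ = a * b * (g * Φ * cφ * n (x - y)) := by ring
  have hchain : a * b * (g * Φ * cφ * n (x - y)) ≤ a * b * (1 / 2 * B (x - y) (x - y)) :=
    mul_le_mul_of_nonneg_left (hmq.trans (by linarith)) hab0
  have hc : c = a * c + b * c := by rw [← add_mul, hab, one_mul]
  linarith [hV, hrem, hchain, hB, hℓ, hc]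

/-- **THE CLAUSE AT PRINT's BOOKKEEPING, AS A `g`-SMALLNESS LINE.**  With the support `χ({|B′| < M₀g_k⁻¹ε_k})` of (1.2) and
`ε_k = g_kA₀p₀(g_k)` ([Balaban1988LargeFieldIII] (2.2)) the window letter is `Φ ≤ K·p₀(g_k)` (`K = ‖∂H_{1,k}‖M₀A₀`, as in
`B16Txt357ThirdOrderU1.ineq12V_U1`); then the smallness `4d(100M)^{d+1}·c_φ·K·(g·p₀(g)) ≤ γ₀` implies ★'s clause.
[cite: Balaban1989LargeFieldII, (1.9) p.358] -/
theorem clauseU1_of_smallness {g Φ K p₀g cφ γ₀ M : ℝ} {d : ℕ} (hg : 0 ≤ g) (hcφ : 0 ≤ cφ) (hM : 0 < M)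
    (hΦ : Φ ≤ K * p₀g) (hsmall : 4 * d * (100 * M) ^ (d + 1) * cφ * K * (g * p₀g) ≤ γ₀) :
    4 * d * (100 * M) ^ (d + 1) * (g * Φ * cφ) ≤ γ₀ := by
  have h1 : g * Φ * cφ ≤ g * (K * p₀g) * cφ :=
    mul_le_mul_of_nonneg_right (mul_le_mul_of_nonneg_left hΦ hg) hcφ
  calc 4 * d * (100 * M) ^ (d + 1) * (g * Φ * cφ) ≤ 4 * d * (100 * M) ^ (d + 1) * (g * (K * p₀g) * cφ) :=
        mul_le_mul_of_nonneg_left h1 (by positivity)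
    _ = 4 * d * (100 * M) ^ (d + 1) * cφ * K * (g * p₀g) := by ring
    _ ≤ γ₀ := hsmall

/-- **"FOR `g_k` SUFFICIENTLY SMALL."**  If the window profile satisfies `g·p₀(g) → 0` as `g → 0⁺` (e.g. `p₀` a power of
`log g⁻²`, [Balaban1988LargeFieldIII] (2.2)), then the smallness line of `clauseU1_of_smallness` holds eventually:
`∀ᶠ g → 0⁺, 4d(100M)^{d+1}·c_φ·K·(g·p₀(g)) ≤ γ₀` (`γ₀ > 0`). [cite: Balaban1989LargeFieldII, (1.9) p.358] -/
theorem eventually_smallnessU1 {K cφ γ₀ M : ℝ} {d : ℕ} (p₀ : ℝ → ℝ) (hγ₀ : 0 < γ₀)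
    (hp : Tendsto (fun g => g * p₀ g) (𝓝[>] 0) (𝓝 0)) :
    ∀ᶠ g in 𝓝[>] 0, 4 * d * (100 * M) ^ (d + 1) * cφ * K * (g * p₀ g) ≤ γ₀ := by
  have h := hp.const_mul (4 * d * (100 * M) ^ (d + 1) * cφ * K)
  rw [mul_zero] at h
  exact h.eventually_le_const hγ₀

end Block

/-! ## §4  A6 witness: every binder of ★ inhabited by a one-plaquette lattice datum, the clause with equality -/

section Witness

/-- **A6 WITNESS OF ★** (director-ym STANDING A6 RULE №189 (3)): one plaquette (`ι = Fin 1`), the chart `E = ℝ` with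
`∂H = (v ↦ (v))`, weight `ζ = 1`, background angle `θ = 0`, `g = ¼`, window `K = [−1, 1]` (`Φ = 1`, `gΦ = ¼ ≤ ½`),
quadratic member `B(x, y) = xy`, `ℓ = 0`, `c = 0`, size letter `n(u) = u²` with `c_φ = 1`, the (1.9) row at
`γ₀ = 1`, `d = 1`, `M = 1∕100` (`½u² ≤ u²`), and the clause `4·1·1·(¼·1·1) = 1 ≤ 1` WITH EQUALITY.  The exponent is then
`½v² + 16·V12 ¼ 1 0 (v) = 16(1 − cos(v∕4))` — ★ certifies that this one-plaquette action is CONVEX on `[−1, 1]`.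
A satisfiability witness, not an estimate on Bałaban's measure. [textbook] -/
theorem sect1ExponentU1_binders_inhabited :
    ConvexOn ℝ (Icc (-1 : ℝ) 1) (fun v : ℝ =>
      1 / 2 * v ^ 2 + 16 * V12 (1 / 4) (fun _ : Fin 1 => (1 : ℝ)) (fun _ => 0) (fun _ => v)) := by
  refine convexOn_sect1ExponentU1 (ι := Fin 1) (convex_Icc _ _) _ (LinearMap.mul ℝ ℝ) 0 0 (fun u => u ^ 2)
    (LinearMap.pi fun _ : Fin 1 => LinearMap.id) (ζ := fun _ => 1) (fun _ => 0) (g := 1 / 4) (Φ := 1) (cφ := 1)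
    (γ₀ := 1) (M := 1 / 100) (d := 1) (by norm_num) zero_le_one (by norm_num) (fun _ => zero_le_one) le_rfl
    (by norm_num) ?_ ?_ ?_ ?_ ?_ ?_
  · -- hexp: `½v² + 16·V = 0 + ½·(v·v) + 0 + (1∕(¼)²)·V`
    intro v _
    have e : ((LinearMap.pi fun _ : Fin 1 => LinearMap.id : ℝ →ₗ[ℝ] (Fin 1 → ℝ)) v) = fun _ => v := by
      funext p; simp
    rw [e, LinearMap.mul_apply', LinearMap.zero_apply]
    norm_num
    ring
  · -- hwin: `|v| ≤ 1` on `[−1, 1]`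
    intro v hv p
    simpa [abs_le] using hv
  · -- h19 (1.9) as a real inequality: `1∕(2·1·1²)·(x−y)² ≤ (x−y)(x−y)`
    intro x _ y _
    unfold Ineq19
    rw [LinearMap.mul_apply']
    norm_num
    nlinarith [sq_nonneg (x - y)]
  · -- hn
    intro x _ y _
    positivity
  · -- hcφ: `Σ_{Fin 1} 1·(x−y)² ≤ 1·(x−y)²`
    intro x _ y _
    simp
  · -- the clause WITH EQUALITY
    norm_num

end Witness

end Summit.QuantumFields.YangMills.Theorems.N21Sect1RemainderSecondOrderU1
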